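import Summits.NavierStokesRegularity.NavierStokesRegularity.Theorems.ArgmaxDoorsEngine
import Summits.NavierStokesRegularity.NavierStokesRegularity.Theorems.ArgmaxDoorsThreshold
import Summits.NavierStokesRegularity.NavierStokesRegularity.Theorems.ArgmaxDoorsDepletion
import Summits.NavierStokesRegularity.NavierStokesRegularity.Theorems.ArgmaxDoorsPhase
import HarnessLib

/-!
# S35 «ArgmaxDoors» — the doors CLOSED BY NAME (door A now; doors B/C appended when Φ / D land)

Summits-side closers (theorems only) for door family S35 of the `NoTypeII` door programme (nsreg-p1 g29,
ROUND-33; texts of record `r33/Sketch35.lean` v3 93168f45ce53c5c4 = tree P0 `Theorems/ArgmaxDoorsDefs.lean`,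
p645080). Each door is the kernel-checked composition of P0 applied to the landed plates:

* door A `argmaxIntegralDoor_holds : ArgmaxIntegralDoor` := `argmaxIntegralDoor_of_engine` E
  (`argmaxEngine_holds`, `Theorems/ArgmaxDoorsEngine.lean`; engine = E1 `inner_vorticity_rhs_le_at_argmax` +
  E2 `norm_le_mul_exp_of_argmax_inner_timeDeriv_le` + frame `vorticity_uniform_decay`).

Doors B (`argmaxSubcriticalDoor_of` E Φ) and C (`argmaxCoherenceDoor_of_plates` D E Φ) are appended (append
protocol) when Φ «PhaseLemma» (ns-sfl-p1 g5) and D «PointDepletion» land.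

HONEST FRAME: regularity CRITERIA read at ONE POINT PER TIME (a vorticity argmax, twist-credited); door A is
type-blind; UNCONDITIONAL (no named-fact hypothesis); item 0056 `NoTypeII` and NS regularity are NOT proved
by this; `--supports stmt-NavierStokesRegularity-0056 --as helper`.
-/

noncomputable section

set_option linter.dupNamespace false

namespace Summit.NavierStokesRegularity.NavierStokesRegularity.Theorems.ArgmaxDoors

/-- **Door S35-A «ArgmaxIntegralDoor» CLOSED BY NAME** (E «ArgmaxEngine» + P0's composition
`argmaxIntegralDoor_of_engine`, BKM `exists_gt_norm_curl_of_not_hasSobolevExtensionPast`). [folklore] -/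
theorem argmaxIntegralDoor_holds : ArgmaxIntegralDoor :=
  argmaxIntegralDoor_of_engine argmaxEngine_holds

/-- **Door S35-C «ArgmaxCoherenceDoor» CLOSED BY NAME** (Constantin–Fefferman at ONE point), THROUGH plate D:
P0's composition `argmaxCoherenceDoor_of : PointDepletion → ArgmaxSubcriticalDoor → ArgmaxCoherenceDoor` applied to
D `pointDepletion_holds` (ns-sfl-p1 g5, `Theorems/ArgmaxDoorsDepletion.lean`, p646609) and door B closed by the LEAD's
threshold route `argmaxSubcriticalDoor_holds_of_threshold` (`Theorems/ArgmaxDoorsThreshold.lean`, p646275; barrier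
supersolution, no phase lemma).  On the charged hypothesis (planner nsreg-p1 g29, ROUND-33 v1.1 F1): `depletionIntegral`
is a Bochner integral, and `pointDepletion_holds` delivers `Integrable` of its integrand at every `(t, x)` with
`ω(x,t) ≠ 0` in the frame, so the junk-value convention never enters the hypothesis of door C.  Appended by
ns-s29-p2 g4 on the LEAD's key 15:36:54Z / word 16:13:49Z; the route-of-record closers through Φ
(`argmaxSubcriticalDoor_of argmaxEngine_holds phaseLemma_holds`, `argmaxCoherenceDoor_of_plates …`) are appended next.
(Door A's content beyond BKM-at-the-maximum, ROUND-33 v1.1 F2: the twist credit `−ν|∇ξ(x̄)|²_F|ω(x̄)|²` in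
`netStretch`, and singular integrable rates — only the primitive `Φ ≤ C` is charged.)  UNCONDITIONAL; item 0056
`NoTypeII` and NS regularity are NOT proved. [folklore] -/
theorem argmaxCoherenceDoor_holds : ArgmaxCoherenceDoor :=
  argmaxCoherenceDoor_of pointDepletion_holds argmaxSubcriticalDoor_holds_of_threshold

/-! ### The routes of record through Φ (kernel-checked; no second named closer)

The gate's dedup lint refuses a second declaration of an already-closed door statement, so the planner's routes of
record E + Φ (door B) and D + E + Φ (door C) are recorded here as kernel-checked `example`s (LEAD ns-s30-p1 g3's key
15:36:54Z «both routes stand»; appended by ns-s29-p2 g4 once `…Theorems.ArgmaxDoorsPhase` was built): door B =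
`argmaxSubcriticalDoor_of argmaxEngine_holds phaseLemma_holds` (E p646272 + Φ p645605/p648025 + F in P0), door C =
`argmaxCoherenceDoor_of_plates pointDepletion_holds argmaxEngine_holds phaseLemma_holds` (D p646609).  The NAMED
closers remain `argmaxSubcriticalDoor_holds_of_threshold` (`…ArgmaxDoorsThreshold`) and `argmaxCoherenceDoor_holds`
above.  UNCONDITIONAL; 0056 `NoTypeII` / NS regularity NOT proved. -/

-- door B along the route of record E + Φ
example : ArgmaxSubcriticalDoor :=
  argmaxSubcriticalDoor_of argmaxEngine_holds phaseLemma_holds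

-- door C along the route of record D + E + Φ
example : ArgmaxCoherenceDoor :=
  argmaxCoherenceDoor_of_plates pointDepletion_holds argmaxEngine_holds phaseLemma_holds

end Summit.NavierStokesRegularity.NavierStokesRegularity.Theorems.ArgmaxDoors

end
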